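/-
Copyright: the b2b-balaban T⁴-continuum CRUX team, row NE7b, leaf lineage `t4-ne7b-formalise-leaf-02` (gen 132). Project licence.
-/
import Literature.MathematicalPhysics.QuantumFieldTheory.Balaban1983to89.B7Prop3GeneralLinearBound
import Summits.QuantumFields.BalabanUV.T4Continuum.Spine.NE7b.LinearisedLatticeStokesRectangle
import Summits.QuantumFields.BalabanUV.T4Continuum.Spine.NE7b.LinearisedLatticeStokesUnitary
import Summits.QuantumFields.BalabanUV.T4Continuum.Spine.NE7b.RotatedSumPairHolonomy

/-!
# LEMMA CS (i) AT ONE STEP IN [B7]'s CURRENCY: the rotated sum of a 1-form around a coordinate rectangle IS the sum of the transported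
# covariant curls of its plaquettes up to a curvature defect `≤ 2·Σ_rows (row curvature)·(row size budget)` — leaf-05's linearised
# non-abelian Stokes END (`LinearisedLatticeStokesRectangle.norm_rectWord_sub_sum_le`) read through the dictionary
# (`RotatedSumPairHolonomy.toAdd_left_hol_eq_tsum_hom`) for ANY structure group `ι : G →* 𝔸ˣ` valued in `{|u| ≤ 1, |u⁻¹| ≤ 1}` and
# dominated by the instance's `dist1`; the cell's `U(n) ⊂ M_n(ℂ)ˣ` (operator norm) is such a structure group, constant `2`
# (row NE7b, node U5c; `HOME/b2b-balaban-r1/SectE-interface-proof.md` §5.2 Lemma CS (i)–(ii); E-side key reading)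

Cell `pub-balaban`, sub-cell `t4`, spine estimate NE7b (`T4WeightBudget.RelWeightBound`; the cell's OWN estimate — NOT PRINTED in
[Bałaban 1983–89], NOT PROVED).  Crux-route work under `Spine/NE7b/` by the row's E-side ∕ key-readings ∕ lattice-geometry leaf lineage;
[folklore] lattice gauge algebra on ONE configuration; NOTHING of Bałaban's is asserted beyond what the imported Literature modules define; no
`T4Continuum/Support` leaf typed; no `def`, no notation, no instance (the [B7] background `V₀ = ι ∘ U` is carried by a characterising
hypothesis `hV₀`); zero `sorry`.  Imports, REUSED BY NAME: leaf-05 g154's `…LinearisedLatticeStokesRectangle` (`norm_rectWord_sub_sum_le` — THE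
END of the linearised Stokes packet in normed letters) and `…LinearisedLatticeStokesUnitary` (the cell's `U(n)`: `dist1_unitaryGroup_eq`, the
`GaugeGroup (Matrix.unitaryGroup n ℂ)` instance of `UnitaryModel`), this lineage's `…RotatedSumPairHolonomy` (§2 `exists_mulAut_conjR`: `R` as
the hom the packet wants; §5 `toAdd_left_hol_eq_tsum_hom`: the dictionary for a general structure group), `Literature.….B7Prop3GeneralLinearBound`
(`norm_conjR_sub_self_le`: `‖R(u)Z − Z‖ ≤ 2ε‖Z‖` for `u ∈ U1`, `‖u − 1‖ ≤ ε`; through it `B7Prop3GeneralRotated.tsum` = `(R_{0,y}A)(Γ)` of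
[B7] p. 28, `norm_conjR_le`, and `B7Eq78Linearization.conjR` = `R(X)Y = XYX⁻¹` of (56)).

WHY (located).  Lemma CS of the memo, step (i): «the covariant boundary sum of `A` around the block surface `S_x(P)` equals the surface sum
of the transported covariant curls `Ad(W)F_A(p)`, `p ⊂ S_x(P)`, up to the curvature of the background».  Leaf-05's packet proves exactly
this for pair configurations `W = ⟨A, U⟩ : bonds → N ⋊[φ] G` over a `GaugeGroup G` (`norm_rectWord_sub_sum_le`, sizes `‖toAdd ·‖`, two
additive letters «`φ` isometric» + «`‖φ(g)v − v‖ ≤ c·dist1 g·‖v‖`»), while the (h1)-slot files of this lineage (`…OneStepCovariantStokes`: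
Lemma CS (ii) at `k = 1` against (125)) are written on [B7]'s rotated sums `tsum V₀ A y Γ ∈ 𝔸` with `V₀ : bonds → 𝔸ˣ` — and `𝔸ˣ` is NOT a
`GaugeGroup`.  Print's structure group is `G = U(N) ⊂ M_N(ℂ)ˣ`: a hom `ι : G →* 𝔸ˣ`.  THIS FILE closes the gap once and for all structure
groups of that kind: §1 proves the END on `tsum (ι ∘ U) A` for any `ι` with `ι(G) ⊂ U1 𝔸 = {|u| ≤ 1, |u⁻¹| ≤ 1}` and `‖ι g − 1‖ ≤ dist1 g`
(then `R ∘ ι` is isometric and has conjugation defect `2·dist1`, [B7]'s `norm_conjR_sub_self_le`), §2 discharges both letters on the cell's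
`U(n)` with the operator norm (`‖g‖ = 1`, `dist1 g = ‖g − 1‖` by `rfl`).  After it, the rectangle term `‖(R_{0,y}A)(∂R_{L,L})‖` of
`OneStepCovariantStokes.norm_coarseCurl_Q0cov_le` is bounded by the fine covariant curls inside the block square plus `2·(row curvature)·(sizes)`
— the shape the Cauchy–Schwarz ∕ counting of (5.2) consumes (`…CovariantStokesCounting`, `…BlockSurfaceCounting`, `…BlockSquareRowMultiplicity`).

WHAT IS PROVED ([folklore]; `𝔸` a normed ring with `‖1‖ = 1` — [B7]'s (19); `G` any `GaugeGroup`):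
* §1 **`norm_tsum_rectWord_sub_sum_le`** — LEMMA CS (i) AT `k = 1` IN [B7]'s CURRENCY, GENERAL STRUCTURE GROUP: for `ι : G →* 𝔸ˣ` with
  `hU1 : ι g ∈ U1 𝔸`, `hdist : ‖ι g − 1‖ ≤ dist1 g`, a `G`-valued background `U`, its [B7] reading `V₀ = ι ∘ U` (`hV₀`), a 1-form `A`, and the
  `n × K` coordinate rectangle at `x` in the `(κ, μ)`-plane:
  `‖(R_{0,x}A)(∂R) − Σ_{j<K} Σ_{i<n} R(ι T_{ij}) (R_{0,x_{ij}}A)(∂p_{ij})‖ ≤ 2·Σ_{j<K} S_j·B_j`, `x_{ij} = x + ie_κ + je_μ`,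
  `T_{ij} = U(∂R_{n,j})·U([x, x+je_μ])·U([x+je_μ, x+je_μ+ie_κ])` (leaf-05's comparison transports, kept verbatim), `S_j = Σ_{i<n} dist1 U(∂p_{ij})`
  the curvature of row `j`, `B_j = ‖(R_{0,x}A)([x, x+je_μ])‖ + Σ_{i<n} (‖A(x+je_μ+ie_κ, κ)‖ + ‖(R_{0,·}A)(∂p_{ij})‖)` its size budget;
  **`norm_tsum_rectWord_le`** — the consumer's form `‖(R_{0,x}A)(∂R)‖ ≤ Σ_{ij} ‖(R_{0,x_{ij}}A)(∂p_{ij})‖ + 2·Σ_j S_j B_j` (`R(ι T)` is an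
  isometry: private `norm_conjR_eq`); **`norm_tsum_rectWord_le_of_dist1_le`** — with a row-curvature letter `dist1 U(∂p) ≤ α` on the plane:
  `≤ Σ_{ij} ‖F_{ij}‖ + 2·(n·α)·Σ_j B_j`.
* §2 **`toUnits_mem_U1`**, **`norm_toUnits_sub_one_le_dist1`** — THE CELL's `U(n)` IS SUCH A STRUCTURE GROUP: for `ι = Unitary.toUnits :
  U(n) →* M_n(ℂ)ˣ` (operator norm, `n` non-empty) `ι g ∈ U1` (`Literature.MathematicalPhysics.QuantumFieldTheory.Balaban1983to89.UnitaryModel.norm_of_mem_unitaryGroup`) and `‖ι g − 1‖ = dist1 g`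
  (`LinearisedLatticeStokesUnitary.dist1_unitaryGroup_eq`); **`norm_tsum_rectWord_le_unitary`** — §1's consumer form on `U(n)` with the row
  curvature read as [B7]'s plaquette deviation `‖V₀(∂p) − 1‖ ≤ α` of the matrix-valued background `V₀ = ι ∘ U` ((44)'s letter).

NOT HERE (honest): Lemma CS (ii) (`…OneStepCovariantStokes[Value]`), the side sums `‖(R_{0,x}A)([x, x+je_μ])‖ ≤ Σ‖A‖`
(`OneStepCovariantStokes.norm_tsum_seg_le_sum`), the Cauchy–Schwarz ∕ counting of (5.2) and every normalisation `η`, `L^{−(d+1)}`, the torus,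
`k > 1` (composed averaging `Q_k = Q^k` up to (R-M)), (R-M) ∕ (R-V), any value of `ε_F`, `c_g`; WHICH `𝔸`, `G` are Bałaban's beyond «`U(N) ⊂
M_N(ℂ)`» ((A3) ∕ (A1c), NC-NE7b-α UNRULED).  BY-NAME EFFECT ON THE WALL: NONE (a junction of two typed packets; the wall is (R2)).  NE7b NOT
PRINTED ∕ NOT PROVED; spine PROVED 0∕9; rung (B)+1 on a FINITE torus — NOT infinite volume, NOT the mass gap, NOT Clay.
HONEST DEPENDENCY: continuum YM on T⁴ ⇐ BetaPertH ∧ nine spine estimates (0/9 proved); BetaPertH ⇐ (D1) ∧ (D4) ∧ CAP+tail; G-an2-4 gates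
asym, D1 and NE2/3/4.
-/

set_option autoImplicit false

noncomputable section

open scoped BigOperators
open Literature.MathematicalPhysics.QuantumFieldTheory.Balaban1983to89 (GaugeGroup dist1)
open Literature.MathematicalPhysics.QuantumFieldTheory.Balaban1983to89.B7Prop1Explicit
  (Site Letter e hol seg plaqWord U1 mem_U1)
open Literature.MathematicalPhysics.QuantumFieldTheory.Balaban1983to89.B7Eq78Linearization (conjR conjR_apply)
open Literature.MathematicalPhysics.QuantumFieldTheory.Balaban1983to89.B7Prop3GeneralRotated (tsum norm_conjR_le conjR_mul_left)
open Literature.MathematicalPhysics.QuantumFieldTheory.Balaban1983to89.B7Prop3GeneralLinearBound (norm_conjR_sub_self_le)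
open Summit.QuantumFields.BalabanUV.T4Continuum.NE7b.NonAbelianStokesBound (rectWord)

namespace Summit.QuantumFields.BalabanUV.T4Continuum.NE7b.RotatedSumRectangleStokes

variable {d : ℕ}

/-! ## §1 The rectangle END on [B7]'s rotated sums, for a structure group `ι : G →* 𝔸ˣ` valued in `U1` and dominated by `dist1` -/

section StructureGroup

variable {𝔸 : Type*} [NormedRing 𝔸] [NormOneClass 𝔸]

/-- `R(u)` is an isometry for `u ∈ U1` (`norm_conjR_le` twice; the products form is `T4TermwiseBCH.norm_units_conj_eq`). [folklore] -/
private theorem norm_conjR_eq {u : 𝔸ˣ} (hu : u ∈ U1 𝔸) (X : 𝔸) : ‖conjR u X‖ = ‖X‖ := by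
  refine le_antisymm (norm_conjR_le hu X) ?_
  have h := norm_conjR_le ((U1 𝔸).inv_mem hu) (conjR u X)
  rw [← conjR_mul_left, inv_mul_cancel] at h
  simpa [conjR_apply] using h

variable {G : Type*} [GaugeGroup G] (ι : G →* 𝔸ˣ) (hU1 : ∀ g, ι g ∈ U1 𝔸)
  (hdist : ∀ g, ‖((ι g : 𝔸ˣ) : 𝔸) - 1‖ ≤ dist1 g)
  (U : Site d → Fin d → G) (A : Site d → Fin d → 𝔸) {V₀ : Site d → Fin d → 𝔸ˣ} (hV₀ : ∀ y ν, V₀ y ν = ι (U y ν))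

include hU1 hdist hV₀ in
/-- **LEMMA CS (i) AT ONE STEP IN [B7]'s CURRENCY, GENERAL STRUCTURE GROUP.**  For `ι : G →* 𝔸ˣ` valued in `U1` with `‖ι g − 1‖ ≤ dist1 g`,
a background `U` read in [B7] as `V₀ = ι ∘ U`, a 1-form `A` and the `n × K` rectangle at `x` in the `(κ, μ)`-plane:
`‖(R_{0,x}A)(∂R) − Σ_{j<K}Σ_{i<n} R(ι T_{ij})·(R_{0,x+ie_κ+je_μ}A)(∂p_{ij})‖ ≤ 2·Σ_j (Σ_i dist1 U(∂p_{ij}))·(‖(R_{0,x}A)([x,x+je_μ])‖ +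
Σ_i (‖A(x+je_μ+ie_κ,κ)‖ + ‖(R_{0,·}A)(∂p_{ij})‖))` — leaf-05's `norm_rectWord_sub_sum_le` for the pair configuration `⟨ofAdd ∘ A, U⟩` over
`φ = R ∘ ι` (`RotatedSumPairHolonomy.exists_mulAut_conjR`), whose two additive letters hold with `c = 2` (`norm_conjR_le`,
`B7Prop3GeneralLinearBound.norm_conjR_sub_self_le`), read through `RotatedSumPairHolonomy.toAdd_left_hol_eq_tsum_hom`. [folklore] -/
theorem norm_tsum_rectWord_sub_sum_le (x : Site d) (κ μ : Fin d) (n K : ℕ) :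
    ‖tsum V₀ A x (rectWord κ μ n K)
        - ∑ j ∈ Finset.range K, ∑ i ∈ Finset.range n,
            conjR (ι (hol U x (rectWord κ μ n j) * hol U x (seg μ (j : ℤ)) * hol U (x + (j : ℤ) • e μ) (seg κ (i : ℤ))))
              (tsum V₀ A (x + (i : ℤ) • e κ + (j : ℤ) • e μ) (plaqWord κ μ))‖
      ≤ 2 * ∑ j ∈ Finset.range K,
          (∑ i ∈ Finset.range n, dist1 (hol U (x + (j : ℤ) • e μ + (i : ℤ) • e κ) (plaqWord κ μ))) *
            (‖tsum V₀ A x (seg μ (j : ℤ))‖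
              + ∑ i ∈ Finset.range n, (‖A (x + (j : ℤ) • e μ + (i : ℤ) • e κ) κ‖
                  + ‖tsum V₀ A (x + (j : ℤ) • e μ + (i : ℤ) • e κ) (plaqWord κ μ)‖)) := by
  classical
  have hV : V₀ = fun y ν => ι (U y ν) := funext fun y => funext fun ν => hV₀ y ν
  subst hV
  -- the hom the packet wants for the structure group, `φ = R ∘ ι`
  obtain ⟨φ, hφ⟩ : ∃ φ : G →* MulAut (Multiplicative 𝔸),
      ∀ (g : G) (a : Multiplicative 𝔸), (φ g a).toAdd = conjR (ι g) a.toAdd := by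
    obtain ⟨φ₀, hφ₀⟩ := RotatedSumPairHolonomy.exists_mulAut_conjR (𝔸 := 𝔸)
    exact ⟨φ₀.comp ι, fun g a => hφ₀ (ι g) a⟩
  -- the pair configuration `W = ⟨ofAdd ∘ A, U⟩`
  let W : Site d → Fin d → Multiplicative 𝔸 ⋊[φ] G := fun y ν => ⟨Multiplicative.ofAdd (A y ν), U y ν⟩
  have hWl : ∀ y ν, (W y ν).left = Multiplicative.ofAdd (A y ν) := fun _ _ => rfl
  have hWr : ∀ y ν, (W y ν).right = U y ν := fun _ _ => rfl
  -- the two additive letters with `c = 2`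
  have hiso : ∀ (g : G) (a : Multiplicative 𝔸), ‖(φ g a).toAdd‖ = ‖a.toAdd‖ := fun g a => by
    rw [hφ]; exact norm_conjR_eq (hU1 g) _
  have hdef : ∀ (g : G) (a : Multiplicative 𝔸), ‖(φ g a).toAdd - a.toAdd‖ ≤ 2 * dist1 g * ‖a.toAdd‖ := fun g a => by
    rw [hφ]; exact norm_conjR_sub_self_le (hU1 g) (hdist g) _
  have h := LinearisedLatticeStokesRectangle.norm_rectWord_sub_sum_le φ W U hWr (c := (2 : ℝ)) (by norm_num) hiso hdef x κ μ n K
  simp only [RotatedSumPairHolonomy.toAdd_left_hol_eq_tsum_hom ι hφ W hWl hWr, hφ, hWl, toAdd_ofAdd] at h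
  exact h

include hU1 hdist hV₀ in
/-- **THE CONSUMER's FORM**: `‖(R_{0,x}A)(∂R_{n,K})‖ ≤ Σ_{j<K}Σ_{i<n} ‖(R_{0,x+ie_κ+je_μ}A)(∂p_{ij})‖ + 2·Σ_j S_j·B_j` — the transports
`R(ι T_{ij})` are isometries, so the main term is bounded by the fine covariant curls inside the rectangle. [folklore] -/
theorem norm_tsum_rectWord_le (x : Site d) (κ μ : Fin d) (n K : ℕ) :
    ‖tsum V₀ A x (rectWord κ μ n K)‖
      ≤ (∑ j ∈ Finset.range K, ∑ i ∈ Finset.range n, ‖tsum V₀ A (x + (i : ℤ) • e κ + (j : ℤ) • e μ) (plaqWord κ μ)‖)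
        + 2 * ∑ j ∈ Finset.range K,
          (∑ i ∈ Finset.range n, dist1 (hol U (x + (j : ℤ) • e μ + (i : ℤ) • e κ) (plaqWord κ μ))) *
            (‖tsum V₀ A x (seg μ (j : ℤ))‖
              + ∑ i ∈ Finset.range n, (‖A (x + (j : ℤ) • e μ + (i : ℤ) • e κ) κ‖
                  + ‖tsum V₀ A (x + (j : ℤ) • e μ + (i : ℤ) • e κ) (plaqWord κ μ)‖)) := by
  have key : ∀ (a b : 𝔸) (s β : ℝ), ‖a - b‖ ≤ β → ‖b‖ ≤ s → ‖a‖ ≤ s + β := fun a b s β h1 h2 => by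
    have h3 := norm_sub_norm_le a b
    linarith
  refine key _ _ _ _ (norm_tsum_rectWord_sub_sum_le ι hU1 hdist U A hV₀ x κ μ n K) ?_
  refine (norm_sum_le _ _).trans (Finset.sum_le_sum fun j _ => (norm_sum_le _ _).trans (Finset.sum_le_sum fun i _ => ?_))
  exact norm_conjR_le (hU1 _) _

include hU1 hdist hV₀ in
/-- **… WITH A ROW-CURVATURE LETTER**: if every plaquette of the plane has `dist1 U(∂p) ≤ α`, then
`‖(R_{0,x}A)(∂R_{n,K})‖ ≤ Σ_{ij} ‖(R_{0,·}A)(∂p_{ij})‖ + 2·(n·α)·Σ_{j<K} B_j`. [folklore] -/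
theorem norm_tsum_rectWord_le_of_dist1_le (κ μ : Fin d) {α : ℝ} (hα : ∀ y : Site d, dist1 (hol U y (plaqWord κ μ)) ≤ α)
    (x : Site d) (n K : ℕ) :
    ‖tsum V₀ A x (rectWord κ μ n K)‖
      ≤ (∑ j ∈ Finset.range K, ∑ i ∈ Finset.range n, ‖tsum V₀ A (x + (i : ℤ) • e κ + (j : ℤ) • e μ) (plaqWord κ μ)‖)
        + 2 * ((n : ℝ) * α) * ∑ j ∈ Finset.range K,
            (‖tsum V₀ A x (seg μ (j : ℤ))‖
              + ∑ i ∈ Finset.range n, (‖A (x + (j : ℤ) • e μ + (i : ℤ) • e κ) κ‖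
                  + ‖tsum V₀ A (x + (j : ℤ) • e μ + (i : ℤ) • e κ) (plaqWord κ μ)‖)) := by
  refine (norm_tsum_rectWord_le ι hU1 hdist U A hV₀ x κ μ n K).trans (add_le_add le_rfl ?_)
  rw [mul_assoc]
  refine mul_le_mul_of_nonneg_left ?_ (by norm_num)
  rw [Finset.mul_sum]
  refine Finset.sum_le_sum fun j _ => mul_le_mul_of_nonneg_right ?_ (by positivity)
  calc ∑ i ∈ Finset.range n, dist1 (hol U (x + (j : ℤ) • e μ + (i : ℤ) • e κ) (plaqWord κ μ))
        ≤ ∑ _i ∈ Finset.range n, α := Finset.sum_le_sum fun i _ => hα _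
      _ = (n : ℝ) * α := by rw [Finset.sum_const, Finset.card_range, nsmul_eq_mul]

end StructureGroup

/-! ## §2 The cell's `U(n) ⊂ M_n(ℂ)ˣ` with the operator norm is such a structure group (constant `2`) -/

section UnitaryGroup

open scoped Matrix.Norms.L2Operator

variable {n : Type*} [Fintype n] [DecidableEq n] [Nonempty n]

/-- `ι = Unitary.toUnits` takes values in `U1 (M_n(ℂ)) = {|u| ≤ 1, |u⁻¹| ≤ 1}`: a unitary has operator norm `1`
(`Literature.MathematicalPhysics.QuantumFieldTheory.Balaban1983to89.UnitaryModel.norm_of_mem_unitaryGroup`). [folklore] -/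
theorem toUnits_mem_U1 (g : Matrix.unitaryGroup n ℂ) :
    (Unitary.toUnits g : (Matrix n n ℂ)ˣ) ∈ U1 (Matrix n n ℂ) := by
  rw [mem_U1, ← map_inv, Unitary.val_toUnits_apply, Unitary.val_toUnits_apply]
  exact ⟨(Literature.MathematicalPhysics.QuantumFieldTheory.Balaban1983to89.UnitaryModel.norm_of_mem_unitaryGroup g.2).le, (Literature.MathematicalPhysics.QuantumFieldTheory.Balaban1983to89.UnitaryModel.norm_of_mem_unitaryGroup (g⁻¹).2).le⟩

/-- `‖ι g − 1‖ = dist1 g` for the cell's `U(n)` instance (`LinearisedLatticeStokesUnitary.dist1_unitaryGroup_eq`). [folklore] -/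
theorem norm_toUnits_sub_one_le_dist1 (g : Matrix.unitaryGroup n ℂ) :
    ‖((Unitary.toUnits g : (Matrix n n ℂ)ˣ) : Matrix n n ℂ) - 1‖ ≤ dist1 g := by
  rw [Unitary.val_toUnits_apply, LinearisedLatticeStokesUnitary.dist1_unitaryGroup_eq]

/-- **LEMMA CS (i) AT ONE STEP ON THE CELL's `U(n)`, BY VALUE.**  For a `U(n)`-valued background `U`, its matrix reading `V₀ = ι ∘ U`
(`ι = Unitary.toUnits`), a matrix-valued 1-form `A`, and the plaquette-deviation letter `‖V₀(∂p) − 1‖ ≤ α` on the `(κ, μ)`-plane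
((44)'s letter, in [B7]'s currency): `‖(R_{0,x}A)(∂R_{n,K})‖ ≤ Σ_{j<K}Σ_{i<n} ‖(R_{0,x+ie_κ+je_μ}A)(∂p_{ij})‖ + 2·(n·α)·Σ_{j<K}
(‖(R_{0,x}A)([x,x+je_μ])‖ + Σ_{i<n} (‖A(x+je_μ+ie_κ,κ)‖ + ‖(R_{0,·}A)(∂p_{ij})‖))`. [folklore] -/
theorem norm_tsum_rectWord_le_unitary (U : Site d → Fin d → Matrix.unitaryGroup n ℂ) (A : Site d → Fin d → Matrix n n ℂ)
    {V₀ : Site d → Fin d → (Matrix n n ℂ)ˣ} (hV₀ : ∀ y ν, V₀ y ν = Unitary.toUnits (U y ν))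
    (κ μ : Fin d) {α : ℝ} (hα : ∀ y : Site d, ‖((hol V₀ y (plaqWord κ μ) : (Matrix n n ℂ)ˣ) : Matrix n n ℂ) - 1‖ ≤ α)
    (x : Site d) (m K : ℕ) :
    ‖tsum V₀ A x (rectWord κ μ m K)‖
      ≤ (∑ j ∈ Finset.range K, ∑ i ∈ Finset.range m, ‖tsum V₀ A (x + (i : ℤ) • e κ + (j : ℤ) • e μ) (plaqWord κ μ)‖)
        + 2 * ((m : ℝ) * α) * ∑ j ∈ Finset.range K,
            (‖tsum V₀ A x (seg μ (j : ℤ))‖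
              + ∑ i ∈ Finset.range m, (‖A (x + (j : ℤ) • e μ + (i : ℤ) • e κ) κ‖
                  + ‖tsum V₀ A (x + (j : ℤ) • e μ + (i : ℤ) • e κ) (plaqWord κ μ)‖)) := by
  refine norm_tsum_rectWord_le_of_dist1_le (Unitary.toUnits : Matrix.unitaryGroup n ℂ →* (Matrix n n ℂ)ˣ) toUnits_mem_U1
    norm_toUnits_sub_one_le_dist1 U A hV₀ κ μ (fun y => ?_) x m K
  -- `dist1 U(∂p) = ‖V₀(∂p) − 1‖`: the instance's `dist1` is the operator-norm distance, and `ι` commutes with transport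
  have hV : V₀ = fun z ν => Unitary.toUnits (U z ν) := funext fun z => funext fun ν => hV₀ z ν
  have h := hα y
  rw [hV, ← LinearisedLatticeStokes.map_hol (Unitary.toUnits : Matrix.unitaryGroup n ℂ →* (Matrix n n ℂ)ˣ) U y,
    Unitary.val_toUnits_apply] at h
  rwa [LinearisedLatticeStokesUnitary.dist1_unitaryGroup_eq]

end UnitaryGroup

end Summit.QuantumFields.BalabanUV.T4Continuum.NE7b.RotatedSumRectangleStokes

end
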